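import Mathlib.Analysis.Analytic.Order
import Mathlib.Analysis.Calculus.IteratedDeriv.Lemmas
import Mathlib.Analysis.Complex.Basic
import HarnessLib

/-!
# The first non-vanishing jet through a non-vanishing factor

Topic: `Literature/NumberTheory/Transcendental`. Plan item W4/S5(e1) of the unit
`provefact-Literature.NumberTheory.Transcendental.H-b596640137`. In Baker's method on `M_κ` the
value of a form `F_P` along a line is, near a point, `Θ_{J₀}^D · E` with `E` the chart expression
(`LineJetsBasic.thetaEval_eq_pow_mul_eval_chart`); `LineJetsBasic.forall_iteratedDeriv_mul_eq_zero_iff`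
transfers the VANISHING of jets through the non-vanishing factor. Here the complementary
statement for the FIRST possibly non-zero jet, PROVED:

* `iteratedDeriv_eq_mul_of_lowerJets_eq_zero` — if `f = g·h` near `c` (analytic), and the jets of
  `h` of orders `< k` vanish at `c`, then `f^{(k)}(c) = g(c)·h^{(k)}(c)` (the difference
  `(g - g(c))·h` has order `≥ k + 1`; no Leibniz expansion needed).

## References

* A. Baker, G. Wüstholz, *Logarithmic Forms and Diophantine Geometry*, CUP 2007, §6.8 (p. 119:
  `Ψ(s) = ϱ^δ ξ`).
-/

noncomputable section

open Filter Topology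

namespace Literature.NumberTheory.Transcendental

/-- **First jet through a non-vanishing factor.** If `f = g·h` near `c` with `g, h` analytic at
`c` and `h^{(i)}(c) = 0` for `i < k`, then `f^{(k)}(c) = g(c)·h^{(k)}(c)`. [folklore] -/
theorem iteratedDeriv_eq_mul_of_lowerJets_eq_zero {f g h : ℂ → ℂ} {c : ℂ} (hg : AnalyticAt ℂ g c)
    (hh : AnalyticAt ℂ h c) (hfg : f =ᶠ[𝓝 c] fun z => g z * h z) {k : ℕ}
    (hk : ∀ i < k, iteratedDeriv i h c = 0) :
    iteratedDeriv k f c = g c * iteratedDeriv k h c := by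
  -- the difference `(g - g c)·h` has order `≥ k + 1`
  set d : ℂ → ℂ := fun z => (g z - g c) * h z with hd
  have hg' : AnalyticAt ℂ (fun z => g z - g c) c := hg.sub analyticAt_const
  have hdan : AnalyticAt ℂ d c := hg'.mul hh
  have hord_g : ((1 : ℕ) : ℕ∞) ≤ analyticOrderAt (fun z => g z - g c) c := by
    rw [natCast_le_analyticOrderAt_iff_iteratedDeriv_eq_zero hg']
    intro i hi
    obtain rfl : i = 0 := by omega
    simp
  have hord_h : ((k : ℕ) : ℕ∞) ≤ analyticOrderAt h c :=
    (natCast_le_analyticOrderAt_iff_iteratedDeriv_eq_zero hh).mpr hk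
  have hord_d : (((k + 1 : ℕ)) : ℕ∞) ≤ analyticOrderAt d c := by
    have hmul : analyticOrderAt d c = analyticOrderAt (fun z => g z - g c) c + analyticOrderAt h c :=
      analyticOrderAt_mul hg' hh
    rw [hmul]
    calc (((k + 1 : ℕ)) : ℕ∞) = ((1 : ℕ) : ℕ∞) + (k : ℕ) := by push_cast; ring
      _ ≤ analyticOrderAt (fun z => g z - g c) c + analyticOrderAt h c := add_le_add hord_g hord_h
  have hdk : iteratedDeriv k d c = 0 :=
    (natCast_le_analyticOrderAt_iff_iteratedDeriv_eq_zero hdan).mp hord_d k (Nat.lt_succ_self k)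
  -- `f = g(c)·h + d` near `c`
  have hsplit : f =ᶠ[𝓝 c] fun z => g c * h z + d z := by
    filter_upwards [hfg] with z hz
    rw [hz, hd]; ring
  rw [hsplit.iteratedDeriv_eq k]
  have h1 : ContDiffAt ℂ k (fun z => g c * h z) c := (hh.contDiffAt.of_le le_top).const_smul (g c) |>.congr_of_eventuallyEq
    (Eventually.of_forall fun z => by simp [smul_eq_mul])
  have h2 : ContDiffAt ℂ k d c := hdan.contDiffAt.of_le le_top
  rw [show (fun z => g c * h z + d z) = (fun z => g c * h z) + d from rfl, iteratedDeriv_add h1 h2, hdk, add_zero,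
    iteratedDeriv_const_mul_field]
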